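import Mathlib
import HarnessLib
import Literature.MathematicalPhysics.StatisticalMechanics.StepMeasureComparisonTraceSegment
import Literature.MathematicalPhysics.StatisticalMechanics.SecondDifferenceSubdivision
import Literature.MathematicalPhysics.QuantumFieldTheory.GaussianCovarianceComparisonTraceSecond

/-!
# The dimension-free SECOND-ORDER comparison for Fourier-multiplier covariances on the torus, and its
# no-smallness segment form: `‖E_{m₂}H − 2E_{(m₀+m₂)/2}H + E_{m₀}H‖ ≤ 27 q² h_T² N_p`
# ([Buc16] Thm 4.5 with `ℓ = 2` / [ABKM19] Lemma 8.4 (`ℓ = 2`) preparation)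

`StepMeasureComparisonTrace(Segment)` turns the dimension-free `ℓ = 1` comparison of centred Gaussians into
the form the renormalisation-group files consume: multiplier covariances `mulMat m`, the Hilbert–Schmidt
datum as the explicit mode sum `Σ_κ (1 − m₀(κ)/m₁(κ))²`, and NO smallness along the segment
`m_t = m₀ + t(m₁ − m₀)` (telescoping).  This file does the same for the SECOND difference
(`GaussianCovarianceComparisonTraceSecond`):

* `trace_mulMat_two_sub_inv_mul_sq` — the second-order datum
  `tr((mulMat m₀ · (2(mulMat m₀)⁻¹ − (mulMat m₁)⁻¹ − (mulMat m₂)⁻¹))²) = Σ_κ (2 − m₀/m₁ − m₀/m₂)²`;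
* **`norm_integral_mulMat_secondDiff_le_of_sum_sq`** — small-step form for three even positive multipliers
  (`m₀` the centre): `‖E_{m₁}H + E_{m₂}H − 2E_{m₀}H‖ ≤ (100q²h² + 4qk)(∫‖H‖^p dN(0, mulMat m₀))^{1/p}`;
* `sum_sq_one_sub_mulSeg_div_le'`, `sum_sq_two_sub_mulSeg_div_le` — along the segment with the two-sided
  relative bound `|m₂ − m₀| ≤ ρ m₀, ρ m₂`: first-order sizes `(t−s)² Σρ²` and, at an EXACT midpoint, the
  second-order size `Σ_κ (2 − m_t/m_{t−δ} − m_t/m_{t+δ})² ≤ 4δ⁴(Σρ²)²` (mode-wise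
  `2 − c/(c−e) − c/(c+e) = −2e²/((c−e)(c+e))`);
* **`norm_integral_mulMat_secondDiff_le_of_sum_sq_segment`** — NO smallness: subdividing `[0,1]` into `2n`
  equal steps (`n ≥ 2q h_T`) and `SecondDifferenceSubdivision.norm_sub_two_smul_add_le_sq_mul`,
  `‖∫H dN(0,mulMat m₂) − 2∫H dN(0, mulMat ½(m₀+m₂)) + ∫H dN(0,mulMat m₀)‖ ≤ 27 q² h_T² N_p`
  for `H ∈ L^p` with `(∫‖H‖^p)^{1/p} ≤ N_p` along the segment.

Everything is proved; no named fact.  (This is the "first bracket" `E_{C₂} − 2E_{C̄} + E_{C₀}` of the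
`ℓ = 2` kernel comparison; the "second bracket" `2[E_{C̄} − E_{C₁}]` is first order and already in the tree,
`FluctuationKernelComparisonMid*`.)

## References
* S. Buchholz, J. Funct. Anal. 275 (2018), Thm 4.5 [Buchholz2016].
* S. Adams, S. Buchholz, R. Kotecký, S. Müller, arXiv:1910.13564, Remark 7.4, Lemma 8.4 (`ℓ = 2`)
  [AdamsBuchholzKoteckyMuller2019].
-/

noncomputable section

namespace Literature.MathematicalPhysics.StatisticalMechanics.GradientRG

open scoped BigOperators Matrix
open MeasureTheory ProbabilityTheory Finset WithLp
open Literature.MathematicalPhysics.StatisticalMechanics.GradientFRD (mulMat mulMat_mul mulMat_one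
  mulMat_inv mulMat_sub mulMat_add trace_mulMat posDef_mulMat)
open Literature.MathematicalPhysics.QuantumFieldTheory

variable {d M : ℕ} [NeZero M]

/-! ## The second-order Hilbert–Schmidt datum of three multiplier covariances -/

/-- `mulMat m₀ · ((m₀⁻¹ − m₁⁻¹) + (m₀⁻¹ − m₂⁻¹)) = mulMat (2 − m₀/m₁ − m₀/m₂)` (multiplier matrices).
[cite: AdamsBuchholzKoteckyMuller2019, Remark 7.4] -/
theorem mulMat_mul_inv_sub_inv_add {m₀ m₁ m₂ : (Fin d → ZMod M) → ℝ} (h0 : ∀ κ, m₀ κ ≠ 0)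
    (h1 : ∀ κ, m₁ κ ≠ 0) (h2 : ∀ κ, m₂ κ ≠ 0) (he0 : ∀ κ, m₀ (-κ) = m₀ κ) (he1 : ∀ κ, m₁ (-κ) = m₁ κ)
    (he2 : ∀ κ, m₂ (-κ) = m₂ κ) :
    mulMat m₀ * (((mulMat m₀)⁻¹ - (mulMat m₁)⁻¹) + ((mulMat m₀)⁻¹ - (mulMat m₂)⁻¹)) =
      mulMat (fun κ => 2 - m₀ κ / m₁ κ - m₀ κ / m₂ κ) := by
  rw [Matrix.mul_add, mulMat_mul_inv_sub_inv h0 h1 he0 he1, mulMat_mul_inv_sub_inv h0 h2 he0 he2,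
    ← mulMat_add]
  congr 1; funext κ; ring

/-- **`tr((mulMat m₀((m₀⁻¹ − m₁⁻¹) + (m₀⁻¹ − m₂⁻¹)))²) = Σ_κ (2 − m₀(κ)/m₁(κ) − m₀(κ)/m₂(κ))²`** — the
second-order Hilbert–Schmidt datum of three multiplier Gaussians is the mode sum of the squared second
differences of the relative precisions. [cite: Buchholz2016, Thm 4.5 (proof, (4.36))] -/
theorem trace_mulMat_two_sub_inv_mul_sq {m₀ m₁ m₂ : (Fin d → ZMod M) → ℝ} (h0 : ∀ κ, m₀ κ ≠ 0)
    (h1 : ∀ κ, m₁ κ ≠ 0) (h2 : ∀ κ, m₂ κ ≠ 0) (he0 : ∀ κ, m₀ (-κ) = m₀ κ) (he1 : ∀ κ, m₁ (-κ) = m₁ κ)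
    (he2 : ∀ κ, m₂ (-κ) = m₂ κ) :
    ((mulMat m₀ * (((mulMat m₀)⁻¹ - (mulMat m₁)⁻¹) + ((mulMat m₀)⁻¹ - (mulMat m₂)⁻¹))) *
      (mulMat m₀ * (((mulMat m₀)⁻¹ - (mulMat m₁)⁻¹) + ((mulMat m₀)⁻¹ - (mulMat m₂)⁻¹)))).trace
      = ∑ κ, (2 - m₀ κ / m₁ κ - m₀ κ / m₂ κ) ^ 2 := by
  have hev : ∀ κ, (fun κ => 2 - m₀ κ / m₁ κ - m₀ κ / m₂ κ) (-κ) =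
      (fun κ => 2 - m₀ κ / m₁ κ - m₀ κ / m₂ κ) κ := fun κ => by
    simp only [he0, he1, he2]
  rw [mulMat_mul_inv_sub_inv_add h0 h1 h2 he0 he1 he2, mulMat_mul hev hev, trace_mulMat]
  exact sum_congr rfl fun κ _ => by ring

/-! ## The small-step second-order comparison for multiplier covariances -/

/-- **Dimension-free second-order comparison of three multiplier Gaussians, Banach-valued functionals**
(the form [ABKM19] Lemma 8.4 (`ℓ = 2`) consumes): for even multipliers `m₀, m₁, m₂ > 0` (`m₀` the centre)
with `Σ_κ (1 − m₀/m₁)² ≤ h²`, `Σ_κ (1 − m₀/m₂)² ≤ h²` (`0 ≤ h ≤ 1/(4q)`), `Σ_κ (2 − m₀/m₁ − m₀/m₂)² ≤ k²`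
(`k ≥ 0`), `H ∈ L^p(N(0, mulMat m₀))` and `N(0, mulMat m_i)`-integrable:
`‖∫H dN(0,mulMat m₁) + ∫H dN(0,mulMat m₂) − 2∫H dN(0,mulMat m₀)‖ ≤ (100q²h² + 4qk)(∫‖H‖^p dN(0,mulMat m₀))^{1/p}`.
[cite: Buchholz2016, Thm 4.5] -/
theorem norm_integral_mulMat_secondDiff_le_of_sum_sq {m₀ m₁ m₂ : (Fin d → ZMod M) → ℝ}
    (h0 : ∀ κ, 0 < m₀ κ) (h1 : ∀ κ, 0 < m₁ κ) (h2 : ∀ κ, 0 < m₂ κ) (he0 : ∀ κ, m₀ (-κ) = m₀ κ)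
    (he1 : ∀ κ, m₁ (-κ) = m₁ κ) (he2 : ∀ κ, m₂ (-κ) = m₂ κ) {h k : ℝ} (hh0 : 0 ≤ h) (hk0 : 0 ≤ k)
    (hsum₁ : ∑ κ, (1 - m₀ κ / m₁ κ) ^ 2 ≤ h ^ 2) (hsum₂ : ∑ κ, (1 - m₀ κ / m₂ κ) ^ 2 ≤ h ^ 2)
    (hsum₁₂ : ∑ κ, (2 - m₀ κ / m₁ κ - m₀ κ / m₂ κ) ^ 2 ≤ k ^ 2)
    {p q : ℝ} (hpq : p.HolderConjugate q) (hhq : h ≤ 1 / (4 * q))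
    {F : Type*} [NormedAddCommGroup F] [NormedSpace ℝ F] [CompleteSpace F]
    {H : EuclideanSpace ℝ (Fin d → ZMod M) → F}
    (hH : MemLp H (ENNReal.ofReal p) (multivariateGaussian 0 (mulMat m₀)))
    (hH₁ : Integrable H (multivariateGaussian 0 (mulMat m₁)))
    (hH₂ : Integrable H (multivariateGaussian 0 (mulMat m₂))) :
    ‖∫ y, H y ∂(multivariateGaussian 0 (mulMat m₁)) + ∫ y, H y ∂(multivariateGaussian 0 (mulMat m₂)) -
        (2 : ℝ) • ∫ y, H y ∂(multivariateGaussian 0 (mulMat m₀))‖ ≤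
      (100 * q ^ 2 * h ^ 2 + 4 * q * k) *
        (∫ y, ‖H y‖ ^ p ∂(multivariateGaussian 0 (mulMat m₀))) ^ (1 / p) := by
  have h0' : ∀ κ, m₀ κ ≠ 0 := fun κ => (h0 κ).ne'
  have h1' : ∀ κ, m₁ κ ≠ 0 := fun κ => (h1 κ).ne'
  have h2' : ∀ κ, m₂ κ ≠ 0 := fun κ => (h2 κ).ne'
  have htr₁ : ((mulMat m₀ * ((mulMat m₀)⁻¹ - (mulMat m₁)⁻¹)) *
      (mulMat m₀ * ((mulMat m₀)⁻¹ - (mulMat m₁)⁻¹))).trace ≤ h ^ 2 := by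
    rw [trace_mulMat_one_sub_inv_mul_sq h0' h1' he0 he1]; exact hsum₁
  have htr₂ : ((mulMat m₀ * ((mulMat m₀)⁻¹ - (mulMat m₂)⁻¹)) *
      (mulMat m₀ * ((mulMat m₀)⁻¹ - (mulMat m₂)⁻¹))).trace ≤ h ^ 2 := by
    rw [trace_mulMat_one_sub_inv_mul_sq h0' h2' he0 he2]; exact hsum₂
  have htr₁₂ : ((mulMat m₀ * (((mulMat m₀)⁻¹ - (mulMat m₁)⁻¹) + ((mulMat m₀)⁻¹ - (mulMat m₂)⁻¹))) *
      (mulMat m₀ * (((mulMat m₀)⁻¹ - (mulMat m₁)⁻¹) + ((mulMat m₀)⁻¹ - (mulMat m₂)⁻¹)))).trace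
      ≤ k ^ 2 := by
    rw [trace_mulMat_two_sub_inv_mul_sq h0' h1' h2' he0 he1 he2]; exact hsum₁₂
  exact norm_integral_multivariateGaussian_secondDiff_le_of_trace (posDef_mulMat h0) (posDef_mulMat h1)
    (posDef_mulMat h2) hh0 hk0 htr₁ htr₂ htr₁₂ hpq hhq hH hH₁ hH₂

/-! ## Sizes along the segment `m_t = m₀ + t(m₂ − m₀)` -/

/-- First-order sizes along the segment for ANY two points `s, t ∈ [0,1]`:
`Σ_κ (1 − m_s(κ)/m_t(κ))² ≤ (t − s)² Σ_κ ρ(κ)²` (version of `sum_sq_one_sub_mulSeg_div_le` with no order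
between `s` and `t`; only `t ∈ [0,1]` is needed, `s` is any real).
[cite: Buchholz2016, Thm 4.5 (proof)] -/
theorem sum_sq_one_sub_mulSeg_div_le' {m₀ m₁ ρ : (Fin d → ZMod M) → ℝ} (h0 : ∀ κ, 0 < m₀ κ)
    (h1 : ∀ κ, 0 < m₁ κ) (hρ0 : ∀ κ, |m₁ κ - m₀ κ| ≤ ρ κ * m₀ κ) (hρ1 : ∀ κ, |m₁ κ - m₀ κ| ≤ ρ κ * m₁ κ)
    (s : ℝ) {t : ℝ} (ht0 : 0 ≤ t) (ht1 : t ≤ 1) :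
    ∑ κ, (1 - (m₀ κ + s * (m₁ κ - m₀ κ)) / (m₀ κ + t * (m₁ κ - m₀ κ))) ^ 2 ≤
      (t - s) ^ 2 * ∑ κ, ρ κ ^ 2 := by
  rw [Finset.mul_sum]
  refine sum_le_sum fun κ _ => ?_
  have hmt : 0 < (m₀ κ + t * (m₁ κ - m₀ κ)) := mulSeg_pos h0 h1 ht0 ht1 κ
  have hkey : 1 - (m₀ κ + s * (m₁ κ - m₀ κ)) / (m₀ κ + t * (m₁ κ - m₀ κ)) =
      (t - s) * (m₁ κ - m₀ κ) / (m₀ κ + t * (m₁ κ - m₀ κ)) := by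
    rw [eq_div_iff hmt.ne', sub_mul, div_mul_cancel₀ _ hmt.ne']
    ring
  rw [hkey, div_pow, mul_pow, div_le_iff₀ (by positivity)]
  have hρ := abs_sub_le_mul_mulSeg hρ0 hρ1 ht0 ht1 κ
  have h2 : (m₁ κ - m₀ κ) ^ 2 ≤ (ρ κ * (m₀ κ + t * (m₁ κ - m₀ κ))) ^ 2 := by
    rw [← sq_abs (m₁ κ - m₀ κ)]
    exact pow_le_pow_left₀ (abs_nonneg _) hρ 2
  nlinarith [sq_nonneg (t - s)]

/-- **Second-order size at an exact midpoint of the segment**: for `0 ≤ s ≤ t ≤ u ≤ 1` with `t − s = u − t`,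
`Σ_κ (2 − m_t/m_s − m_t/m_u)² ≤ 4 (t − s)⁴ (Σ_κ ρ(κ)²)²` — mode-wise `2 − c/(c−e) − c/(c+e) = −2e²/((c−e)(c+e))`
with `e² ≤ (t−s)²ρ²(c−e)(c+e)` by the two-sided relative bound at the two outer points.
[cite: Buchholz2016, Thm 4.5 (proof)] -/
theorem sum_sq_two_sub_mulSeg_div_le {m₀ m₂ ρ : (Fin d → ZMod M) → ℝ} (h0 : ∀ κ, 0 < m₀ κ)
    (h2 : ∀ κ, 0 < m₂ κ) (hρ0 : ∀ κ, |m₂ κ - m₀ κ| ≤ ρ κ * m₀ κ) (hρ2 : ∀ κ, |m₂ κ - m₀ κ| ≤ ρ κ * m₂ κ)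
    {s t u : ℝ} (hs0 : 0 ≤ s) (hst : s ≤ t) (htu : t - s = u - t) (hu1 : u ≤ 1) :
    ∑ κ, (2 - (m₀ κ + t * (m₂ κ - m₀ κ)) / (m₀ κ + s * (m₂ κ - m₀ κ)) -
        (m₀ κ + t * (m₂ κ - m₀ κ)) / (m₀ κ + u * (m₂ κ - m₀ κ))) ^ 2 ≤
      4 * (t - s) ^ 4 * (∑ κ, ρ κ ^ 2) ^ 2 := by
  have hu : u = 2 * t - s := by linarith
  subst hu
  have hs1 : s ≤ 1 := by linarith
  have hu0 : 0 ≤ 2 * t - s := by linarith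
  have hsq : ∑ κ, (ρ κ ^ 2) ^ 2 ≤ (∑ κ, ρ κ ^ 2) ^ 2 := by
    rw [sq (∑ κ, ρ κ ^ 2), Finset.sum_mul]
    refine Finset.sum_le_sum fun κ _ => ?_
    rw [sq]
    exact mul_le_mul_of_nonneg_left
      (Finset.single_le_sum (f := fun κ => ρ κ ^ 2) (fun _ _ => sq_nonneg _) (Finset.mem_univ κ))
      (sq_nonneg _)
  calc ∑ κ, (2 - (m₀ κ + t * (m₂ κ - m₀ κ)) / (m₀ κ + s * (m₂ κ - m₀ κ)) -
          (m₀ κ + t * (m₂ κ - m₀ κ)) / (m₀ κ + (2 * t - s) * (m₂ κ - m₀ κ))) ^ 2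
      ≤ ∑ κ, 4 * (t - s) ^ 4 * (ρ κ ^ 2) ^ 2 := by
        refine sum_le_sum fun κ _ => ?_
        have ha : 0 < m₀ κ + s * (m₂ κ - m₀ κ) := mulSeg_pos h0 h2 hs0 hs1 κ
        have hb : 0 < m₀ κ + (2 * t - s) * (m₂ κ - m₀ κ) := mulSeg_pos h0 h2 hu0 hu1 κ
        have hρa : |m₂ κ - m₀ κ| ≤ ρ κ * (m₀ κ + s * (m₂ κ - m₀ κ)) :=
          abs_sub_le_mul_mulSeg hρ0 hρ2 hs0 hs1 κ
        have hρb : |m₂ κ - m₀ κ| ≤ ρ κ * (m₀ κ + (2 * t - s) * (m₂ κ - m₀ κ)) :=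
          abs_sub_le_mul_mulSeg hρ0 hρ2 hu0 hu1 κ
        have hkey : 2 - (m₀ κ + t * (m₂ κ - m₀ κ)) / (m₀ κ + s * (m₂ κ - m₀ κ)) -
            (m₀ κ + t * (m₂ κ - m₀ κ)) / (m₀ κ + (2 * t - s) * (m₂ κ - m₀ κ)) =
            -2 * ((t - s) * (m₂ κ - m₀ κ)) ^ 2 /
              ((m₀ κ + s * (m₂ κ - m₀ κ)) * (m₀ κ + (2 * t - s) * (m₂ κ - m₀ κ))) := by
          rw [eq_div_iff (mul_pos ha hb).ne', div_eq_mul_inv, div_eq_mul_inv]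
          linear_combination
            (-((m₀ κ + t * (m₂ κ - m₀ κ)) * (m₀ κ + (2 * t - s) * (m₂ κ - m₀ κ)))) *
                mul_inv_cancel₀ ha.ne' +
              (-((m₀ κ + t * (m₂ κ - m₀ κ)) * (m₀ κ + s * (m₂ κ - m₀ κ)))) * mul_inv_cancel₀ hb.ne'
        rw [hkey, div_pow, div_le_iff₀ (by positivity)]
        have hD2 : (m₂ κ - m₀ κ) ^ 2 ≤
            (ρ κ * (m₀ κ + s * (m₂ κ - m₀ κ))) * (ρ κ * (m₀ κ + (2 * t - s) * (m₂ κ - m₀ κ))) := by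
          rw [← sq_abs, pow_two]
          exact mul_le_mul hρa hρb (abs_nonneg _) ((abs_nonneg _).trans hρa)
        calc (-2 * ((t - s) * (m₂ κ - m₀ κ)) ^ 2) ^ 2 = 4 * (t - s) ^ 4 * ((m₂ κ - m₀ κ) ^ 2) ^ 2 := by
              ring
          _ ≤ 4 * (t - s) ^ 4 *
              ((ρ κ * (m₀ κ + s * (m₂ κ - m₀ κ))) * (ρ κ * (m₀ κ + (2 * t - s) * (m₂ κ - m₀ κ)))) ^ 2 := by
              gcongr
          _ = 4 * (t - s) ^ 4 * (ρ κ ^ 2) ^ 2 *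
              ((m₀ κ + s * (m₂ κ - m₀ κ)) * (m₀ κ + (2 * t - s) * (m₂ κ - m₀ κ))) ^ 2 := by ring
    _ = 4 * (t - s) ^ 4 * ∑ κ, (ρ κ ^ 2) ^ 2 := by rw [← Finset.mul_sum]
    _ ≤ 4 * (t - s) ^ 4 * (∑ κ, ρ κ ^ 2) ^ 2 := mul_le_mul_of_nonneg_left hsq (by positivity)

/-! ## The second-order comparison without smallness -/

/-- **Dimension-free SECOND-ORDER comparison of multiplier Gaussians without smallness** ([Buc16] Thm 4.5
with `ℓ = 2`, integrated second-difference form along the segment of multipliers).  Let `m₀, m₂ > 0` be even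
multipliers with a two-sided relative bound `|m₂ − m₀| ≤ ρ m₀`, `|m₂ − m₀| ≤ ρ m₂` and `Σ_κ ρ(κ)² ≤ h_T²`
(`h_T ≥ 0`); `p, q` Hölder conjugate; `H` Banach-valued with `H ∈ L^p(N(0, mulMat m_t))` and
`(∫ ‖H‖^p dN(0, mulMat m_t))^{1/p} ≤ N_p` for all `t ∈ [0,1]` (`m_t = m₀ + t(m₂ − m₀)`).  Then, with the
midpoint multiplier `½m₀ + ½m₂`,
`‖∫H dN(0, mulMat m₂) − 2∫H dN(0, mulMat (½m₀ + ½m₂)) + ∫H dN(0, mulMat m₀)‖ ≤ 27 q² h_T² N_p`.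
(Subdivide `[0,1]` into `2n` steps, `n ≥ 2q h_T`; each local second difference is at an exact midpoint with
sizes `h = h_T/(2n)`, `k = 2h²`, so costs `≤ 108 q² h² N_p`; `n²` of them.) [cite: Buchholz2016, Thm 4.5] -/
theorem norm_integral_mulMat_secondDiff_le_of_sum_sq_segment {m₀ m₂ ρ : (Fin d → ZMod M) → ℝ}
    (h0 : ∀ κ, 0 < m₀ κ) (h2 : ∀ κ, 0 < m₂ κ) (he0 : ∀ κ, m₀ (-κ) = m₀ κ) (he2 : ∀ κ, m₂ (-κ) = m₂ κ)
    (hρ0 : ∀ κ, |m₂ κ - m₀ κ| ≤ ρ κ * m₀ κ) (hρ2 : ∀ κ, |m₂ κ - m₀ κ| ≤ ρ κ * m₂ κ)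
    {hT : ℝ} (hhT : 0 ≤ hT) (hsum : ∑ κ, ρ κ ^ 2 ≤ hT ^ 2)
    {p q : ℝ} (hpq : p.HolderConjugate q)
    {F : Type*} [NormedAddCommGroup F] [NormedSpace ℝ F] [CompleteSpace F]
    {H : EuclideanSpace ℝ (Fin d → ZMod M) → F}
    (hH : ∀ t ∈ Set.Icc (0 : ℝ) 1, MemLp H (ENNReal.ofReal p)
      (multivariateGaussian 0 (mulMat (fun κ => m₀ κ + t * (m₂ κ - m₀ κ)))))
    {Np : ℝ}
    (hNp : ∀ t ∈ Set.Icc (0 : ℝ) 1,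
      (∫ y, ‖H y‖ ^ p ∂(multivariateGaussian 0 (mulMat (fun κ => m₀ κ + t * (m₂ κ - m₀ κ))))) ^ (1 / p)
        ≤ Np) :
    ‖∫ y, H y ∂(multivariateGaussian 0 (mulMat m₂)) -
        (2 : ℝ) • ∫ y, H y ∂(multivariateGaussian 0 (mulMat (fun κ => 2⁻¹ * m₀ κ + 2⁻¹ * m₂ κ))) +
        ∫ y, H y ∂(multivariateGaussian 0 (mulMat m₀))‖ ≤
      27 * q ^ 2 * hT ^ 2 * Np := by
  have hp1 : 1 < p := hpq.lt
  have hq1 : 1 < q := hpq.symm.lt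
  have hq0 : 0 < q := by linarith
  have hNp0 : 0 ≤ Np :=
    (Real.rpow_nonneg (integral_nonneg fun y => by positivity) _).trans (hNp 0 ⟨le_rfl, zero_le_one⟩)
  -- number of half-steps `2n`, `n ≥ 2 q h_T`, `n ≥ 1`
  set n : ℕ := ⌈2 * q * hT⌉₊ + 1 with hndef
  have hn1 : 1 ≤ n := by rw [hndef]; exact Nat.le_add_left 1 _
  have hnpos : (0 : ℝ) < n := by exact_mod_cast hn1
  have hnge : 2 * q * hT ≤ n := by
    rw [hndef]; push_cast
    exact (Nat.le_ceil _).trans (le_add_of_nonneg_right zero_le_one)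
  -- the step `δ = 1/(2n)`, the nodes `t_j = j/(2n)`, the segment
  set δ : ℝ := 1 / (2 * n) with hδdef
  have hδ0 : 0 ≤ δ := by positivity
  set tn : ℕ → ℝ := fun j => (j : ℝ) / (2 * n) with htn
  have htn0 : ∀ j, 0 ≤ tn j := fun j => by positivity
  have htn1 : ∀ j, j ≤ 2 * n → tn j ≤ 1 := fun j hj => by
    simp only [htn]
    rw [div_le_one (by positivity)]
    exact_mod_cast hj
  have htn_succ : ∀ j, tn (j + 1) = tn j + δ := fun j => by
    simp only [htn, hδdef]; push_cast; ring
  set mseg : ℝ → (Fin d → ZMod M) → ℝ := fun t κ => m₀ κ + t * (m₂ κ - m₀ κ) with hmseg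
  have hmpos : ∀ t, 0 ≤ t → t ≤ 1 → ∀ κ, 0 < mseg t κ := fun t ht0 ht1 κ => mulSeg_pos h0 h2 ht0 ht1 κ
  have hmev : ∀ t κ, mseg t (-κ) = mseg t κ := fun t κ => mulSeg_even he0 he2 t κ
  have hint : ∀ t, 0 ≤ t → t ≤ 1 → Integrable H (multivariateGaussian 0 (mulMat (mseg t))) :=
    fun t ht0 ht1 => (hH t ⟨ht0, ht1⟩).integrable (by
      rw [← ENNReal.ofReal_one]; exact ENNReal.ofReal_le_ofReal hp1.le)
  -- the local sizes
  have hloc : δ * hT ≤ 1 / (4 * q) := by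
    have : δ * hT = hT / (2 * n) := by rw [hδdef]; ring
    rw [this, div_le_div_iff₀ (by positivity) (by positivity)]
    nlinarith
  -- local second differences
  set f : ℕ → F := fun j => ∫ y, H y ∂(multivariateGaussian 0 (mulMat (mseg (tn j)))) with hf
  have hD : ∀ m, m + 2 ≤ 2 * n →
      ‖f (m + 2) - (2 : ℝ) • f (m + 1) + f m‖ ≤ 108 * q ^ 2 * (δ * hT) ^ 2 * Np := by
    intro m hm
    have ht2 : tn (m + 2) ≤ 1 := htn1 _ hm
    have ht1' : tn (m + 1) ≤ 1 := htn1 _ (by omega)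
    have ht0' : tn m ≤ 1 := htn1 _ (by omega)
    have hs1 : tn (m + 1) = tn m + δ := htn_succ m
    have hs2 : tn (m + 2) = tn (m + 1) + δ := htn_succ (m + 1)
    -- first-order sizes of the two half-steps
    have hsumA : ∑ κ, (1 - mseg (tn (m + 1)) κ / mseg (tn m) κ) ^ 2 ≤ (δ * hT) ^ 2 := by
      calc ∑ κ, (1 - mseg (tn (m + 1)) κ / mseg (tn m) κ) ^ 2
          ≤ (tn m - tn (m + 1)) ^ 2 * ∑ κ, ρ κ ^ 2 :=
            sum_sq_one_sub_mulSeg_div_le' h0 h2 hρ0 hρ2 _ (htn0 _) ht0'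
        _ ≤ δ ^ 2 * hT ^ 2 := by
            rw [hs1, show (tn m - (tn m + δ)) ^ 2 = δ ^ 2 by ring]
            exact mul_le_mul_of_nonneg_left hsum (sq_nonneg _)
        _ = (δ * hT) ^ 2 := by ring
    have hsumB : ∑ κ, (1 - mseg (tn (m + 1)) κ / mseg (tn (m + 2)) κ) ^ 2 ≤ (δ * hT) ^ 2 := by
      calc ∑ κ, (1 - mseg (tn (m + 1)) κ / mseg (tn (m + 2)) κ) ^ 2
          ≤ (tn (m + 2) - tn (m + 1)) ^ 2 * ∑ κ, ρ κ ^ 2 :=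
            sum_sq_one_sub_mulSeg_div_le' h0 h2 hρ0 hρ2 _ (htn0 _) ht2
        _ ≤ δ ^ 2 * hT ^ 2 := by
            rw [hs2, show (tn (m + 1) + δ - tn (m + 1)) ^ 2 = δ ^ 2 by ring]
            exact mul_le_mul_of_nonneg_left hsum (sq_nonneg _)
        _ = (δ * hT) ^ 2 := by ring
    -- second-order size at the midpoint
    have hsumC : ∑ κ, (2 - mseg (tn (m + 1)) κ / mseg (tn m) κ -
        mseg (tn (m + 1)) κ / mseg (tn (m + 2)) κ) ^ 2 ≤ (2 * (δ * hT) ^ 2) ^ 2 := by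
      have hst : tn m ≤ tn (m + 1) := by rw [hs1]; linarith
      have htu : tn (m + 1) - tn m = tn (m + 2) - tn (m + 1) := by rw [hs2, hs1]; ring
      calc ∑ κ, (2 - mseg (tn (m + 1)) κ / mseg (tn m) κ - mseg (tn (m + 1)) κ / mseg (tn (m + 2)) κ) ^ 2
          ≤ 4 * (tn (m + 1) - tn m) ^ 4 * (∑ κ, ρ κ ^ 2) ^ 2 :=
            sum_sq_two_sub_mulSeg_div_le h0 h2 hρ0 hρ2 (htn0 _) hst htu ht2
        _ ≤ 4 * δ ^ 4 * (hT ^ 2) ^ 2 := by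
            rw [hs1, show (tn m + δ - tn m) ^ 4 = δ ^ 4 by ring]
            exact mul_le_mul_of_nonneg_left
              (pow_le_pow_left₀ (sum_nonneg fun κ _ => sq_nonneg _) hsum 2) (by positivity)
        _ = (2 * (δ * hT) ^ 2) ^ 2 := by ring
    have hstep := norm_integral_mulMat_secondDiff_le_of_sum_sq (hmpos _ (htn0 _) ht1') (hmpos _ (htn0 _) ht0')
      (hmpos _ (htn0 _) ht2) (hmev _) (hmev _) (hmev _) (by positivity : 0 ≤ δ * hT)
      (by positivity : 0 ≤ 2 * (δ * hT) ^ 2) hsumA hsumB hsumC hpq hloc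
      (hH _ ⟨htn0 _, ht1'⟩) (hint _ (htn0 _) ht0') (hint _ (htn0 _) ht2)
    have hNp' := hNp _ ⟨htn0 (m + 1), ht1'⟩
    have hrew : f (m + 2) - (2 : ℝ) • f (m + 1) + f m =
        f m + f (m + 2) - (2 : ℝ) • f (m + 1) := by abel
    rw [hrew]
    refine hstep.trans ?_
    have hq2 : 100 * q ^ 2 * (δ * hT) ^ 2 + 4 * q * (2 * (δ * hT) ^ 2) ≤ 108 * q ^ 2 * (δ * hT) ^ 2 := by
      have hX : 0 ≤ (δ * hT) ^ 2 := sq_nonneg _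
      have h3 : 0 ≤ q * (q - 1) * (δ * hT) ^ 2 := mul_nonneg (mul_nonneg hq0.le (by linarith)) hX
      nlinarith
    calc (100 * q ^ 2 * (δ * hT) ^ 2 + 4 * q * (2 * (δ * hT) ^ 2)) *
          (∫ y, ‖H y‖ ^ p ∂(multivariateGaussian 0 (mulMat (mseg (tn (m + 1)))))) ^ (1 / p)
        ≤ (100 * q ^ 2 * (δ * hT) ^ 2 + 4 * q * (2 * (δ * hT) ^ 2)) * Np :=
          mul_le_mul_of_nonneg_left hNp' (by positivity)
      _ ≤ 108 * q ^ 2 * (δ * hT) ^ 2 * Np := mul_le_mul_of_nonneg_right hq2 hNp0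
  have hglob := norm_sub_two_smul_add_le_sq_mul f n hD
  -- identify the three nodes `t = 1, ½, 0`
  have h2n : mseg (tn (2 * n)) = m₂ := by
    funext κ
    simp only [hmseg, htn]
    push_cast
    rw [div_self (by positivity)]; ring
  have hnn : mseg (tn n) = fun κ => 2⁻¹ * m₀ κ + 2⁻¹ * m₂ κ := by
    funext κ
    simp only [hmseg, htn]
    rw [show (n : ℝ) / (2 * n) = 2⁻¹ by field_simp]
    ring
  have h00 : mseg (tn 0) = m₀ := by
    funext κ
    simp only [hmseg, htn]
    push_cast
    ring
  have hf2n : f (2 * n) = ∫ y, H y ∂(multivariateGaussian 0 (mulMat m₂)) := by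
    simp only [hf]; rw [h2n]
  have hfn : f n = ∫ y, H y ∂(multivariateGaussian 0 (mulMat (fun κ => 2⁻¹ * m₀ κ + 2⁻¹ * m₂ κ))) := by
    simp only [hf]; rw [hnn]
  have hf0 : f 0 = ∫ y, H y ∂(multivariateGaussian 0 (mulMat m₀)) := by
    simp only [hf]; rw [h00]
  rw [hf2n, hfn, hf0] at hglob
  refine hglob.trans (le_of_eq ?_)
  rw [hδdef]
  field_simp
  ring

end Literature.MathematicalPhysics.StatisticalMechanics.GradientRG

end
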